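import Literature.Analysis.Complex.CartanHeftung
import Literature.Analysis.Complex.RungeUnits
import HarnessLib

/-!
# Cartan's theorem on holomorphic invertible matrices (Cartan 1940), split polydisc form

Let `B' = {a < x < b'} × S`, `B'' = {a' < x < b} × S` (`a ≤ a' < b' ≤ b`, `S` = strip in `y` times a
parameter polydisc in `ℂ^ι`) be a Cartan pair of boxes with overlap `D = {a' < x < b'} × S`, and let
`c` be holomorphic with **invertible** values (in a complete normed `ℂ`-algebra `𝔄` with `‖1‖ = 1`,
e.g. `r × r` matrices) on a neighbourhood of the closure of `D`. Then, on slightly shrunken boxes,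

  `c = c₁ · c₂`  with `c₁ ∈ 𝒪*(B')`, `c₂ ∈ 𝒪*(B'')`

(`cartan_factorization_polydisc`). For `c` close to `1` this is Cartan's Heftungslemma
(`cartan_heftung_polydisc`, Grauert–Remmert Kap. III §1.3 Satz 4); the general case is H. Cartan's
theorem on holomorphic matrices (J. Math. Pures Appl. 19 (1940), Théorème I for the attaching of
"matrices holomorphes inversibles"), reduced to the Heftungslemma by Runge approximation of `c⁻¹` by
maps `û` holomorphic and invertible on the whole `x`-range (`runge_units_rectangle_param`, the convex
case of Grauert's Runge theorem for `GL`): `c û` is close to `1` on `D`, so `c û = c₁ c₂'` by the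
Heftungslemma and `c = c₁ · (c₂' û⁻¹)`.

This is ingredient (4) (with (3) in the convex case) of Grauert's proof of the Oka principle, in the
strength needed to glue local holomorphic trivialisations of a vector bundle over adjacent boxes.

## References

* H. Cartan, *Sur les matrices holomorphes de `n` variables complexes*, J. Math. Pures Appl. 19
  (1940) 1–26, Théorème I [Cartan1940].
* H. Grauert, R. Remmert, *Theorie der Steinschen Räume* (1977), Kap. III §1.3 Satz 4, §2 Satz 1
  [GrauertRemmert1977].
* H. Grauert, Math. Ann. 133 (1957) 139–159, §2 [Grauert1957].
-/

noncomputable section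

open Complex Set Filter Topology Metric

namespace Literature.Analysis.Complex

variable {ι : Type*} [Fintype ι]
  {𝔄 : Type*} [NormedRing 𝔄] [NormedAlgebra ℂ 𝔄] [CompleteSpace 𝔄] [NormOneClass 𝔄]

/-- The open box `{α < x < β, γ < y < δ'} × polydisc p₀ ρ ⊆ ℂ × ℂ^ι` is open. [folklore] -/
theorem isOpen_box_prod_polydisc (α β γ δ' : ℝ) (p₀ : ι → ℂ) (ρ : ι → ℝ) :
    IsOpen {z : ℂ × (ι → ℂ) | α < z.1.re ∧ z.1.re < β ∧ γ < z.1.im ∧ z.1.im < δ' ∧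
      z.2 ∈ polydisc p₀ ρ} := by
  have h : {z : ℂ × (ι → ℂ) | α < z.1.re ∧ z.1.re < β ∧ γ < z.1.im ∧ z.1.im < δ' ∧
      z.2 ∈ polydisc p₀ ρ} = (Prod.fst ⁻¹' (Ioo α β ×ℂ Ioo γ δ')) ∩ (Prod.snd ⁻¹' polydisc p₀ ρ) := by
    ext z; simp only [mem_setOf_eq, mem_inter_iff, mem_preimage, mem_reProdIm, mem_Ioo]; tauto
  rw [h]
  exact ((isOpen_Ioo.reProdIm isOpen_Ioo).preimage continuous_fst).inter
    ((isOpen_polydisc p₀ ρ).preimage continuous_snd)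

omit [Fintype ι] in
/-- The open box `{α < x < β, γ < y < δ'} × polydisc p₀ ρ` is convex. [folklore] -/
theorem convex_box_prod_polydisc (α β γ δ' : ℝ) (p₀ : ι → ℂ) (ρ : ι → ℝ) :
    Convex ℝ {z : ℂ × (ι → ℂ) | α < z.1.re ∧ z.1.re < β ∧ γ < z.1.im ∧ z.1.im < δ' ∧
      z.2 ∈ polydisc p₀ ρ} := by
  have h : {z : ℂ × (ι → ℂ) | α < z.1.re ∧ z.1.re < β ∧ γ < z.1.im ∧ z.1.im < δ' ∧
      z.2 ∈ polydisc p₀ ρ} =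
      ((Complex.reLm.comp (LinearMap.fst ℝ ℂ (ι → ℂ))) ⁻¹' Ioo α β ∩
        (Complex.imLm.comp (LinearMap.fst ℝ ℂ (ι → ℂ))) ⁻¹' Ioo γ δ') ∩
      (LinearMap.snd ℝ ℂ (ι → ℂ)) ⁻¹' polydisc p₀ ρ := by
    ext z; simp only [mem_setOf_eq, mem_inter_iff, mem_preimage, LinearMap.coe_comp,
      Function.comp_apply, LinearMap.fst_apply, LinearMap.snd_apply, Complex.reLm_coe,
      Complex.imLm_coe, mem_Ioo]; tauto
  rw [h]
  refine (((convex_Ioo α β).linear_preimage _).inter ((convex_Ioo γ δ').linear_preimage _)).inter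
    (Convex.linear_preimage ?_ _)
  exact convex_pi fun i _ => convex_ball _ _

/-- **Cartan's theorem on holomorphic invertible matrices, split polydisc form** (Cartan 1940,
Théorème I; near the identity: Grauert–Remmert Kap. III §1.3 Satz 4). In the geometry of
`cartan_heftung_polydisc` (`a ≤ a'`, `b' ≤ b`, `a' + δ < b' − δ`, `c + 2ε ≤ d − 2ε`, parameter polydiscs
`D(p₀, r∞) ⊂ D(p₀, r) ⊂ D(p₀, r₁)`): every `c` holomorphic with invertible values on the open box
`{a' − η < x < b' + η, c − η < y < d + η} × D(p₀, r₁)` around the closed overlap is a product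
`c = c₁ c₂` on `{a' < x < b', c + 2ε < y < d − 2ε} × D(p₀, r∞)` of maps `c₁`, `c₂` holomorphic with
invertible values on `{a < x < b', c + 2ε < y < d − 2ε} × D(p₀, r∞)` and
`{a' < x < b, c + 2ε < y < d − 2ε} × D(p₀, r∞)` respectively. [cite: Cartan1940, Théorème I] -/
theorem cartan_factorization_polydisc {a a' b' b δ : ℝ} (haa' : a ≤ a') (hb'b : b' ≤ b)
    (hδ : 0 < δ) (hab : a' + δ < b' - δ) {c d ε : ℝ} (hε : 0 < ε) (hcd : c + 2 * ε ≤ d - 2 * ε)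
    (p₀ : ι → ℂ) {r₁ r rinf : ι → ℝ} (hrinf : ∀ i, 0 < rinf i) (hr : ∀ i, rinf i < r i)
    (hr₁ : ∀ i, r i < r₁ i) {η : ℝ} (hη : 0 < η) {cf : ℂ × (ι → ℂ) → 𝔄}
    (hcf : DifferentiableOn ℂ cf
      {z : ℂ × (ι → ℂ) | a' - η < z.1.re ∧ z.1.re < b' + η ∧ c - η < z.1.im ∧ z.1.im < d + η ∧
        z.2 ∈ polydisc p₀ r₁})
    (hunit : ∀ z : ℂ × (ι → ℂ), a' - η < z.1.re → z.1.re < b' + η → c - η < z.1.im →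
      z.1.im < d + η → z.2 ∈ polydisc p₀ r₁ → IsUnit (cf z)) :
    ∃ c₁ c₂ : ℂ × (ι → ℂ) → 𝔄,
      DifferentiableOn ℂ c₁ {z : ℂ × (ι → ℂ) | a < z.1.re ∧ z.1.re < b' ∧ c + 2 * ε < z.1.im ∧
        z.1.im < d - 2 * ε ∧ z.2 ∈ polydisc p₀ rinf} ∧
      DifferentiableOn ℂ c₂ {z : ℂ × (ι → ℂ) | a' < z.1.re ∧ z.1.re < b ∧ c + 2 * ε < z.1.im ∧
        z.1.im < d - 2 * ε ∧ z.2 ∈ polydisc p₀ rinf} ∧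
      (∀ z : ℂ × (ι → ℂ), a < z.1.re → z.1.re < b' → c + 2 * ε < z.1.im → z.1.im < d - 2 * ε →
        z.2 ∈ polydisc p₀ rinf → IsUnit (c₁ z)) ∧
      (∀ z : ℂ × (ι → ℂ), a' < z.1.re → z.1.re < b → c + 2 * ε < z.1.im → z.1.im < d - 2 * ε →
        z.2 ∈ polydisc p₀ rinf → IsUnit (c₂ z)) ∧
      ∀ z : ℂ × (ι → ℂ), a' < z.1.re → z.1.re < b' → c + 2 * ε < z.1.im → z.1.im < d - 2 * ε →
        z.2 ∈ polydisc p₀ rinf → cf z = c₁ z * c₂ z := by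
  -- Cartan's Heftungslemma for this geometry
  obtain ⟨K, β₀, hK1, hβ₀, hCartan⟩ :=
    cartan_heftung_polydisc (𝔄 := 𝔄) haa' hb'b hδ hab hε hcd p₀ hrinf hr
  have ha'b' : a' ≤ b' := by linarith
  have hcd' : c ≤ d := by linarith
  -- the convex open set `U` carrying `c`, the compact convex parameter set `K'`
  set U : Set (ℂ × (ι → ℂ)) := {z : ℂ × (ι → ℂ) | a' - η < z.1.re ∧ z.1.re < b' + η ∧
    c - η < z.1.im ∧ z.1.im < d + η ∧ z.2 ∈ polydisc p₀ r₁} with hUdef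
  have hUo : IsOpen U := isOpen_box_prod_polydisc _ _ _ _ p₀ r₁
  have hUc : Convex ℝ U := convex_box_prod_polydisc _ _ _ _ p₀ r₁
  have hunit' : ∀ z ∈ U, IsUnit (cf z) := fun z hz => hunit z hz.1 hz.2.1 hz.2.2.1 hz.2.2.2.1 hz.2.2.2.2
  set K' : Set (ι → ℂ) := Set.pi univ fun i => closedBall (p₀ i) (r i) with hK'def
  have hK'c : IsCompact K' := isCompact_univ_pi fun i => isCompact_closedBall _ _
  have hK'conv : Convex ℝ K' := convex_pi fun i _ => convex_closedBall _ _
  have hrK' : polydisc p₀ r ⊆ K' := polydisc_subset_pi_closedBall p₀ r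
  have hK'r₁ : K' ⊆ polydisc p₀ r₁ := pi_closedBall_subset_polydisc p₀ hr₁
  have hrinf_r : polydisc p₀ rinf ⊆ polydisc p₀ r := polydisc_mono p₀ fun i => (hr i).le
  have hη2 : 0 < η / 2 := half_pos hη
  have hsubU : (Icc (a' - η / 2) (b' + η / 2) ×ℂ Icc (c - η / 2) (d + η / 2)) ×ˢ K' ⊆ U := by
    rintro ⟨w, p⟩ ⟨⟨⟨h1, h2⟩, ⟨h3, h4⟩⟩, hp⟩
    exact ⟨by linarith, by linarith, by linarith, by linarith, hK'r₁ hp⟩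
  -- `u = c⁻¹` is holomorphic with invertible values on `U`
  have hu_diff : DifferentiableOn ℂ (fun z => Ring.inverse (cf z)) U := fun z hz =>
    (differentiableAt_inverse (hunit' z hz)).comp_differentiableWithinAt z (hcf z hz)
  have hu_unit : ∀ z ∈ U, IsUnit (Ring.inverse (cf z)) := fun z hz =>
    (hunit' z hz).ringInverse
  -- a bound for `c` on the compact set `[a', b'] × [c, d] × K'`
  set R : Set ℂ := Icc a' b' ×ℂ Icc c d with hRdef
  have hRK'U : R ×ˢ K' ⊆ U := by
    rintro ⟨w, p⟩ ⟨⟨⟨h1, h2⟩, ⟨h3, h4⟩⟩, hp⟩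
    exact ⟨by linarith, by linarith, by linarith, by linarith, hK'r₁ hp⟩
  obtain ⟨M₀, hM₀⟩ := ((isCompact_Icc.reProdIm isCompact_Icc).prod hK'c).exists_bound_of_continuousOn
    (f := cf) (hcf.continuousOn.mono hRK'U)
  set M : ℝ := max M₀ 0 with hMdef
  have hM0 : 0 ≤ M := le_max_right _ _
  have hM : ∀ z ∈ R ×ˢ K', ‖cf z‖ ≤ M := fun z hz => (hM₀ z hz).trans (le_max_left _ _)
  -- Runge for `u` with tolerance `δ₂`
  set δ₂ : ℝ := β₀ / (M + 1) with hδ₂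
  have hδ₂0 : 0 < δ₂ := by positivity
  obtain ⟨û, V, hVo, hKV, hûd, hûu, hû⟩ := runge_units_rectangle_param hUo hUc hu_diff hu_unit
    ha'b' hcd' hη2 hK'c hK'conv hsubU hδ₂0
  -- `af = c û` is close to `1` on the open overlap box
  set af : ℂ × (ι → ℂ) → 𝔄 := fun z => cf z * û z with haf
  have hDU : {z : ℂ × (ι → ℂ) | a' < z.1.re ∧ z.1.re < b' ∧ c < z.1.im ∧ z.1.im < d ∧
      z.2 ∈ polydisc p₀ r} ⊆ U := fun z hz =>
    ⟨by linarith [hz.1], by linarith [hz.2.1], by linarith [hz.2.2.1], by linarith [hz.2.2.2.1],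
      hK'r₁ (hrK' hz.2.2.2.2)⟩
  have hDV : {z : ℂ × (ι → ℂ) | a' < z.1.re ∧ z.1.re < b' ∧ c < z.1.im ∧ z.1.im < d ∧
      z.2 ∈ polydisc p₀ r} ⊆ univ ×ˢ V := fun z hz => ⟨mem_univ _, hKV (hrK' hz.2.2.2.2)⟩
  have haf_diff : DifferentiableOn ℂ af {z : ℂ × (ι → ℂ) | a' < z.1.re ∧ z.1.re < b' ∧
      c < z.1.im ∧ z.1.im < d ∧ z.2 ∈ polydisc p₀ r} := (hcf.mono hDU).mul (hûd.mono hDV)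
  have hN : M * δ₂ ≤ β₀ := by
    rw [hδ₂, mul_div_assoc', div_le_iff₀ (by positivity)]
    nlinarith
  have haf_bound : ∀ z : ℂ × (ι → ℂ), a' < z.1.re → z.1.re < b' → c < z.1.im → z.1.im < d →
      z.2 ∈ polydisc p₀ r → ‖af z - 1‖ ≤ M * δ₂ := by
    intro z h1 h2 h3 h4 h5
    have hzU : z ∈ U := hDU ⟨h1, h2, h3, h4, h5⟩
    have hzR : z.1 ∈ R := ⟨⟨h1.le, h2.le⟩, ⟨h3.le, h4.le⟩⟩
    have hzK : z.2 ∈ K' := hrK' h5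
    have hid : af z - 1 = cf z * (û z - Ring.inverse (cf z)) := by
      simp only [haf]
      rw [mul_sub, Ring.mul_inverse_cancel _ (hunit' z hzU)]
    rw [hid]
    refine (norm_mul_le _ _).trans (mul_le_mul (hM z ⟨hzR, hzK⟩) ?_ (norm_nonneg _) hM0)
    rw [norm_sub_rev]
    have := hû z.1 hzR z.2 hzK
    simpa using this
  -- Cartan's Heftungslemma: `af = c₁ c₂'`
  obtain ⟨c₁, c₂, hc₁d, hc₂d, hc₁u, hc₂u, hfac⟩ :=
    hCartan af (M * δ₂) (by positivity) hN haf_diff haf_bound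
  have hBV : {z : ℂ × (ι → ℂ) | a' < z.1.re ∧ z.1.re < b ∧ c + 2 * ε < z.1.im ∧
      z.1.im < d - 2 * ε ∧ z.2 ∈ polydisc p₀ rinf} ⊆ univ ×ˢ V := fun z hz =>
    ⟨mem_univ _, hKV (hrK' (hrinf_r hz.2.2.2.2))⟩
  refine ⟨c₁, fun z => c₂ z * Ring.inverse (û z), hc₁d, ?_, fun z h1 h2 h3 h4 h5 =>
    (hc₁u z h1 h2 h3 h4 h5).1, ?_, ?_⟩
  · -- `c₂ û⁻¹` is holomorphic on `B''`
    refine hc₂d.mul fun z hz => ?_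
    have hzV : z ∈ univ ×ˢ V := hBV hz
    exact (differentiableAt_inverse (hûu z hzV)).comp_differentiableWithinAt z
      ((hûd z hzV).mono hBV)
  · -- invertible values
    intro z h1 h2 h3 h4 h5
    exact (hc₂u z h1 h2 h3 h4 h5).1.mul (hûu z (hBV ⟨h1, h2, h3, h4, h5⟩)).ringInverse
  · -- the factorisation `c = c₁ (c₂ û⁻¹)`
    intro z h1 h2 h3 h4 h5
    have hzV : z ∈ univ ×ˢ V := hBV ⟨h1, by linarith, h3, h4, h5⟩
    have h' := hfac z h1 h2 h3 h4 h5
    simp only [haf] at h'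
    calc cf z = cf z * û z * Ring.inverse (û z) := by
          rw [mul_assoc, Ring.mul_inverse_cancel _ (hûu z hzV), mul_one]
      _ = c₁ z * (c₂ z * Ring.inverse (û z)) := by rw [h', mul_assoc]

end Literature.Analysis.Complex
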